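/-
Copyright (c) 2026 the pub-hodgecm-mathlib formalisation cell (harness21).  Prover seat hodgecm-mathlib-K2E2-p12 (g5): Track B «K2-LIT», ENGINE E1,
h413 = stmt-HodgeConjecture-24833; (q10) «R7₃-SCALAR» FILE 2(b) «transport», inert part (the dealer K2E1-plan (g4)'s FILE 2 deal 2026-09-04T07:52:58Z, split
announced 07:56:47Z ∕ 08:05:36Z; deck item (ν-5) handed back by K2-defs1 (g5) 08:04:26Z).
-/
import Summits.HodgeConjecture.HodgeConjecture.Theorems.K2LiuLocalRingReImDictionary    -- ★ (K2Liu-p05): `re_im_mem_primePowBall_one_of_forall_lt` (the dictionary `re∕im ↔ 𝔭_w` at `v ∤ 2`, `δ` unit); brings ★ `LocalRing`, `toPlace`, `quadraticLocalEquiv`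
import Literature.NumberTheory.Automorphic.UnitaryGroupNonsplitPlace                     -- ★ `PlacesOver.subsingleton_of_smul_eq` (one place above a non-split `v`)
import Literature.NumberTheory.Automorphic.AddCharConductorExponent                       -- ★ `normAbs_le_normAbs_iff_valued`, `normAbs_eq_inv_zpow_of_valued_eq` (`‖·‖` ↔ `Valued.v`)
import Literature.NumberTheory.Automorphic.AdicCompletionResidueCard                      -- ★ `residueFieldCard_adicCompletion_eq : residueFieldCard K_v = v.residueCard`
import HarnessLib

/-!
# K2·E1 — `K2E1IntertwiningLocalFactorU3Height` ((q10) «R7₃-SCALAR» FILE 2(b), inert part): THE INTEGRAL-BASIS NORM AT A NON-SPLIT UNRAMIFIED PLACE —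
# `|ι_w a + ι_w b·δ|_w = max(|a|_v, |b|_v)`, `|a² − d b²|_v = max(|a|_v,|b|_v)²`, and the `U(2,1)` big-cell height `max(1, ‖X_w‖, ‖Z_w‖) = max(1, max(‖a‖,‖b‖)², ‖t‖)²`

Track B ∕ K2-LIT, crux h413 = `stmt-HodgeConjecture-24833`, route of record `HCCMUnconditional`; cell `hodgecm-mathlib`, squad K2, ENGINE E1 (campaign «EIS-RANK-ONE», R7 at
`N = 3`).  THEOREMS ONLY (no `def`, no instance, no notation, no named-fact hypothesis, no `sorry`; default heartbeats); lane `--supports stmt-HodgeConjecture-24833 --as helper`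
(count-neutral).  Generic quadratic extension of number fields `E ∕ F` with `c`, `δ` (`c δ = −δ ≠ 0`, `δ² = d ∈ F`), currency of ★ `QuadraticLocalBaseChange`:
`LocalRing E v = Π_{w ∣ v} E_w`, `ι_w = toPlace v w : F_v →+* E_w`, `Ψ_v = quadraticLocalEquiv E v c _ _ : F_v × F_v ≃ Π_w E_w`, `Ψ_v(a, b) = ι_v a + ι_v b·δ`.

THE MATHEMATICS [CasselsFrohlichANT1967, Ch. II §10, Ch. I §5; Serre1979, Ch. I §6; Rogawski1990, §4.5].  Let `v ∤ 2` be a finite place of `F` with ONE place `w` of `E`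
above it (`c • w = w`), UNRAMIFIED (`e(w ∣ v) = 1`), and `δ` a unit at `w`.  Then `{1, δ}` is an integral basis of `𝒪_w` over `𝒪_v` and the residue extension has degree
`2`, so the valuation of `E_w` reads off the coordinates:
* §1 **`valued_quadraticLocalEquiv_apply_eq_max`**: `|ι_w a + ι_w b·δ|_w = max(|a|_v, |b|_v)` (as elements of `ℤᵐ⁰`; `≤` is ultrametric, `≥`: after dividing by the larger
  coordinate one of `re, im` is `1`, and `|z|_w < 1` would put `re z, im z ∈ 𝔭_v` by ★ `K2LiuLocalRingReImDictionary.re_im_mem_primePowBall_one_of_forall_lt`).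
* §2 **`valued_sq_sub_mul_sq_eq`**: `|a² − d b²|_v = max(|a|_v, |b|_v)²` (the norm form: `(ι a + ι b δ)(ι a − ι b δ) = ι(a² − d b²)`, and `σ = c ⊗ 1` maps `Ψ(a,b)` to `Ψ(a,−b)`) —
  `d` is a non-square unit at an inert place.
* §3 **in the height currency `‖·‖ = normAbs`** (`q_w = q_v²`, supplied as the hypothesis `w.residueCard = v.residueCard²` — ★
  `Rogawski1990.absNorm_placesOver_eq_sq_of_nonsplit_of_isUnramifiedIn` at the CM pair): `‖ι_w a + ι_w b·δ‖_w = max(‖a‖_v, ‖b‖_v)²`.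
* §4 **THE `U(2,1)` BIG-CELL CORNER AND HEIGHT** (`t ∈ F_v` the trace-zero coordinate): with `X = Ψ_v(a,b)`, `X·σX = ι_v(a² − d b²)` (**`quadraticLocalEquiv_mul_conjLocal`**), so the
  corner entry `Z = ι t·δ − ½X·σX = Ψ_v(−½(a² − d b²), t)` has `|Z_w|_w = max(max(|a|,|b|)², |t|)` (**`valued_corner_eq_max`**), and the finite height factor of E1's flat section
  along the Heisenberg chart (★ (a2)₃ `K2E1HeightBigCellLineFormulaU3`: `max(1, ‖X_w‖, ‖Z_w‖)`) is **`max_one_norm_height_eq_sq`**: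
  `max(1, ‖X_w‖_w, ‖Z_w‖_w) = max(1, max(‖a‖_v,‖b‖_v)², ‖t‖_v)²` — raised to `−σ` this is LITERALLY the integrand `max(1, max(|a|,|b|)², |t|)^{−2σ}` of ★ FILE 2 ED. 2
  `K2E1IntertwiningLocalFactorU3.integral_integral_integral_inertCell_coords_eq` (the inert local factor in base coordinates).
NOT HERE: the split-place transport (the linear change `(a, b, t) ↦ (x, y, z)` to ★ `K2E1GindikinKarpelevichSplitGL3`'s coordinates) and the adelic bookkeeping `X_w = (a + bδ)_w`
(brick «ADELIC-BASIS-TRANSPORT», K2-defs1 (g5)).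
HONEST LABEL: HC_CM is proved only modulo the 7 printed citations (2 remaining named inputs: hLiu418 = `stmt-HodgeConjecture-24832`, h413 = `stmt-HodgeConjecture-24833`) until rung 0
closes; this file asserts no named fact and closes no socket; count-neutral.

## References
* [CasselsFrohlichANT1967] J. W. S. Cassels, A. Fröhlich (eds.), *Algebraic Number Theory* (1967): Ch. I §5 (unramified extensions, integral bases), Ch. II §10 (`L ⊗_K K_v`).
* [Serre1979] J.-P. Serre, *Local Fields* (1979): Ch. I §6 Prop. 15–17 (unramified quadratic extensions; the norm form).
* [Rogawski1990] J. D. Rogawski, *Automorphic Representations of Unitary Groups in Three Variables* (1990): §1.10 (Heisenberg coordinates), §4.5 p. 45.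
-/

set_option autoImplicit false
set_option linter.dupNamespace false -- the mandated namespace repeats `HodgeConjecture.HodgeConjecture`

noncomputable section

open NumberField IsDedekindDomain
open scoped NNReal
open Literature.NumberTheory.Automorphic Literature.NumberTheory.Automorphic.UnitaryGroup
open Literature.NumberTheory.Automorphic.UnitaryGroup.QuadraticCoordinates
open Literature.NumberTheory.GaloisRepresentations.IsNonarchimedeanLocalField
open Summit.HodgeConjecture.HodgeConjecture.Cruxes.HLiu418.K2LiuLocalRingReImDictionary (re_im_mem_primePowBall_one_of_forall_lt)

namespace Summit.HodgeConjecture.HodgeConjecture.Cruxes.H413.K2E1IntertwiningLocalFactorU3Height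

variable {F : Type} [Field F] [NumberField F] (E : Type) [Field E] [NumberField E] [Algebra F E]
  [Algebra.IsQuadraticExtension F E] (c : E ≃ₐ[F] E) {δ : E} (hcδ : c δ = -δ) (hδ : δ ≠ 0) {d : F}
  (hd : δ * δ = algebraMap F E d) (v : HeightOneSpectrum (𝓞 F)) (w : PlacesOver E v)

/-! ## §0 Components of `Ψ_v(a, b) = ι_v a + ι_v b·δ` and the involution -/

include hcδ hδ in
omit [NumberField F] [Algebra.IsQuadraticExtension F E] in
/-- `c ≠ 1` (it negates `δ ≠ 0`). [folklore] -/
theorem ne_one_of_apply_eq_neg : c ≠ 1 := by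
  intro h
  rw [h, AlgEquiv.one_apply] at hcδ
  have h2 : (2 : E) * δ = 0 := by linear_combination hcδ
  exact hδ ((mul_eq_zero.1 h2).resolve_left two_ne_zero)

/-- The `w`-component of `Ψ_v(a, b)`: `(Ψ_v(a,b))_w = ι_w a + ι_w b · δ_w`. [cite: CasselsFrohlichANT1967, Ch. II §10] -/
theorem quadraticLocalEquiv_apply_place (a b : v.adicCompletion F) :
    quadraticLocalEquiv E v c hcδ hδ (a, b) w = toPlace v w a + toPlace v w b * algebraMap E (LocalRing E v) δ w := by
  rw [quadraticLocalEquiv_apply]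
  rfl

include hd in
/-- **THE NORM FORM**: `Ψ_v(a,b) · σ(Ψ_v(a,b)) = ι_v(a² − d b²)` (`σ = c ⊗ 1` sends `Ψ_v(a,b)` to `Ψ_v(a,−b)`, ★ `conjLocal_quadraticLocalEquiv`; multiplication rule ★
`IsQuadraticCoordinates.mul_formula`). [cite: Serre1979, Ch. I §6] -/
theorem quadraticLocalEquiv_mul_conjLocal (a b : v.adicCompletion F) :
    quadraticLocalEquiv E v c hcδ hδ (a, b) * conjLocal E c v (quadraticLocalEquiv E v c hcδ hδ (a, b)) = toLocalRing E v (a ^ 2 - (d : v.adicCompletion F) * b ^ 2) := by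
  have hq := isQuadraticCoordinates_local E v c hcδ hδ hd
  rw [conjLocal_quadraticLocalEquiv, quadraticLocalEquiv_apply, quadraticLocalEquiv_apply]
  dsimp only
  rw [hq.mul_formula, show a * -b + b * a = 0 by ring, map_zero, zero_mul, add_zero]
  congr 1
  ring

/-! ## §1 `|ι_w a + ι_w b·δ|_w = max(|a|_v, |b|_v)` at a non-split unramified place with `δ` a unit and `v ∤ 2` -/

/-- **Upper bound (any place above `v`)**: `|ι_w a + ι_w b·δ|_w ≤ max(|a|_v^{e}, |b|_v^{e}·|δ_w|)`, `e = e(w∣v)` (ultrametric inequality, ★ `valued_toPlace`). [cite: CasselsFrohlichANT1967, Ch. II §10] -/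
theorem valued_quadraticLocalEquiv_apply_le (a b : v.adicCompletion F) :
    Valued.v (quadraticLocalEquiv E v c hcδ hδ (a, b) w) ≤
      max (Valued.v a ^ v.asIdeal.ramificationIdx' w.1.asIdeal) (Valued.v b ^ v.asIdeal.ramificationIdx' w.1.asIdeal * Valued.v (algebraMap E (LocalRing E v) δ w)) := by
  rw [quadraticLocalEquiv_apply_place]
  refine (Valuation.map_add _ _ _).trans ?_
  rw [valued_toPlace, Valuation.map_mul, valued_toPlace]

include hd in
/-- **THE INTEGRAL-BASIS NORM**: at a place `v` with a single place `w` above it (`c • w = w`), unramified (`e(w∣v) = 1`), with `2` a `v`-unit and `δ` a `w`-unit,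
`|ι_w a + ι_w b·δ|_w = max(|a|_v, |b|_v)` for all `a, b ∈ F_v`.  `≤`: ultrametric.  `≥` (say `|b| ≤ |a|`, `a ≠ 0`): `Ψ(a,b) = ι a · Ψ(1, b∕a)`, and `|Ψ(1, b∕a)|_w < 1` is impossible —
it would force `re = 1 ∈ 𝔭_v` by ★ `re_im_mem_primePowBall_one_of_forall_lt` (the only place above `v` being `w`). [cite: CasselsFrohlichANT1967, Ch. I §5] [cite: Serre1979, Ch. I §6] -/
theorem valued_quadraticLocalEquiv_apply_eq_max (hw : c • w.1 = w.1) (he : v.asIdeal.ramificationIdx' w.1.asIdeal = 1)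
    (h2 : Valued.v (2 : v.adicCompletion F) = 1) (hδu : Valued.v (algebraMap E (LocalRing E v) δ w) = 1) (a b : v.adicCompletion F) :
    Valued.v (quadraticLocalEquiv E v c hcδ hδ (a, b) w) = max (Valued.v a) (Valued.v b) := by
  haveI : Subsingleton (PlacesOver E v) := PlacesOver.subsingleton_of_smul_eq c (ne_one_of_apply_eq_neg E c hcδ hδ) w hw
  have hδu' : ∀ w' : PlacesOver E v, Valued.v (algebraMap E (LocalRing E v) δ w') = 1 := fun w' => by rw [Subsingleton.elim w' w]; exact hδu
  refine le_antisymm ?_ ?_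
  · have h := valued_quadraticLocalEquiv_apply_le E c hcδ hδ v w a b
    rwa [he, pow_one, pow_one, hδu, mul_one] at h
  · -- the key step: `|Ψ(a', b')|_w ≥ 1` as soon as one of `a', b'` is `1`
    have one_not_mem : (1 : v.adicCompletion F) ∉ primePowBall (v.adicCompletion F) 1 := by
      rw [mem_primePowBall_iff, map_one, zpow_one, not_le]
      exact inv_residueFieldCard_lt_one
    have key : ∀ a' b' : v.adicCompletion F, (a' = 1 ∨ b' = 1) → 1 ≤ Valued.v (quadraticLocalEquiv E v c hcδ hδ (a', b') w) := by
      intro a' b' hab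
      by_contra hlt
      rw [not_le] at hlt
      have hall : ∀ w' : PlacesOver E v, Valued.v (quadraticLocalEquiv E v c hcδ hδ (a', b') w') < 1 := fun w' => by
        rw [Subsingleton.elim w' w]; exact hlt
      obtain ⟨hre, him⟩ := re_im_mem_primePowBall_one_of_forall_lt E c hcδ hδ hd v h2 hδu' hall
      have hre' : QuadraticCoordinates.re (quadraticLocalEquiv E v c hcδ hδ).toLinearEquiv.toAddEquiv (quadraticLocalEquiv E v c hcδ hδ (a', b')) = a' :=
        QuadraticCoordinates.re_apply _ a' b'
      have him' : QuadraticCoordinates.im (quadraticLocalEquiv E v c hcδ hδ).toLinearEquiv.toAddEquiv (quadraticLocalEquiv E v c hcδ hδ (a', b')) = b' :=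
        QuadraticCoordinates.im_apply _ a' b'
      rw [hre'] at hre
      rw [him'] at him
      rcases hab with h | h
      · exact one_not_mem (h ▸ hre)
      · exact one_not_mem (h ▸ him)
    -- scaling: `Ψ(a, b) = ι u · Ψ(u⁻¹ a, u⁻¹ b)` for the larger coordinate `u`
    have scale : ∀ u : v.adicCompletion F, u ≠ 0 →
        Valued.v (quadraticLocalEquiv E v c hcδ hδ (a, b) w) = Valued.v u * Valued.v (quadraticLocalEquiv E v c hcδ hδ (u⁻¹ * a, u⁻¹ * b) w) := by
      intro u hu
      have hsm : quadraticLocalEquiv E v c hcδ hδ (a, b) = u • quadraticLocalEquiv E v c hcδ hδ (u⁻¹ * a, u⁻¹ * b) := by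
        rw [← map_smul, Prod.smul_mk, smul_eq_mul, smul_eq_mul, mul_inv_cancel_left₀ hu, mul_inv_cancel_left₀ hu]
      rw [hsm, smul_localRing_def, Pi.mul_apply, Valuation.map_mul, toLocalRing_apply, valued_toPlace, he, pow_one]
    rcases le_total (Valued.v b) (Valued.v a) with hba | hab
    · rw [max_eq_left hba]
      by_cases ha : a = 0
      · rw [ha, Valuation.map_zero]
        exact zero_le
      · rw [scale a ha, inv_mul_cancel₀ ha]
        have h1 := key 1 (a⁻¹ * b) (Or.inl rfl)
        calc Valued.v a = Valued.v a * 1 := (mul_one _).symm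
          _ ≤ Valued.v a * Valued.v (quadraticLocalEquiv E v c hcδ hδ (1, a⁻¹ * b) w) := by gcongr
    · rw [max_eq_right hab]
      by_cases hb : b = 0
      · rw [hb, Valuation.map_zero]
        exact zero_le
      · rw [scale b hb, inv_mul_cancel₀ hb]
        have h1 := key (b⁻¹ * a) 1 (Or.inr rfl)
        calc Valued.v b = Valued.v b * 1 := (mul_one _).symm
          _ ≤ Valued.v b * Valued.v (quadraticLocalEquiv E v c hcδ hδ (b⁻¹ * a, 1) w) := by gcongr

/-! ## §2 The norm form: `|a² − d b²|_v = max(|a|_v, |b|_v)²` -/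

include hcδ hδ hd in
/-- **`|a² − d b²|_v = max(|a|_v, |b|_v)²`** at a non-split unramified place with `2`, `δ` units: `ι_v(a² − d b²) = X·σX` for `X = Ψ_v(a,b)` (§0), `σX = Ψ_v(a, −b)`, and both
have `w`-valuation `max(|a|,|b|)` (§1); `e(w∣v) = 1`.  (So `d` is a NON-SQUARE unit of `F_v`: `a² − d b²` has even valuation only.) [cite: Serre1979, Ch. I §6] -/
theorem valued_sq_sub_mul_sq_eq (hw : c • w.1 = w.1) (he : v.asIdeal.ramificationIdx' w.1.asIdeal = 1)
    (h2 : Valued.v (2 : v.adicCompletion F) = 1) (hδu : Valued.v (algebraMap E (LocalRing E v) δ w) = 1) (a b : v.adicCompletion F) :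
    Valued.v (a ^ 2 - (d : v.adicCompletion F) * b ^ 2) = max (Valued.v a) (Valued.v b) ^ 2 := by
  have hprod := congrArg (fun z : LocalRing E v => Valued.v (z w)) (quadraticLocalEquiv_mul_conjLocal E c hcδ hδ hd v a b)
  simp only [Pi.mul_apply, Valuation.map_mul, toLocalRing_apply, valued_toPlace, he, pow_one] at hprod
  rw [← hprod, conjLocal_quadraticLocalEquiv, valued_quadraticLocalEquiv_apply_eq_max E c hcδ hδ hd v w hw he h2 hδu,
    valued_quadraticLocalEquiv_apply_eq_max E c hcδ hδ hd v w hw he h2 hδu, Valuation.map_neg, sq]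

/-! ## §3 The height currency `‖·‖ = normAbs`: `‖ι_w a + ι_w b·δ‖_w = max(‖a‖_v, ‖b‖_v)²` (`q_w = q_v²`) -/

omit [Algebra.IsQuadraticExtension F E] in
/-- **Norm transfer `E_w ↔ F_v`**: if `q_w = q_v²` (`w.residueCard = v.residueCard²`) and `|x|_w = |y|_v` in `ℤᵐ⁰`, then `‖x‖_w = ‖y‖_v²` (`‖·‖ = q^{−ord}`, ★
`normAbs_eq_inv_zpow_of_valued_eq`, ★ `residueFieldCard_adicCompletion_eq`). [cite: CasselsFrohlichANT1967, Ch. II §10] -/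
theorem normAbs_eq_sq_of_valued_eq (hq : w.1.residueCard = v.residueCard ^ 2) {x : w.1.adicCompletion E} {y : v.adicCompletion F}
    (h : Valued.v x = Valued.v y) :
    ((normAbs (w.1.adicCompletion E) x : ℝ≥0) : ℝ) = ((normAbs (v.adicCompletion F) y : ℝ≥0) : ℝ) ^ 2 := by
  by_cases hy : y = 0
  · have hx : x = 0 := by
      rw [hy, Valuation.map_zero] at h
      exact (Valuation.zero_iff _).1 h
    rw [hx, hy, map_zero, map_zero]
    norm_num
  · have hy' : Valued.v y ≠ 0 := (Valuation.ne_zero_iff _).2 hy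
    have hn : Valued.v y = WithZero.exp (WithZero.log (Valued.v y)) := (WithZero.exp_log hy').symm
    have hxn : Valued.v x = WithZero.exp (WithZero.log (Valued.v y)) := h.trans hn
    have hpow : ∀ (x : ℝ≥0) (n : ℤ), (x ^ 2)⁻¹ ^ n = (x⁻¹ ^ n) ^ 2 := fun x n => by
      rw [← inv_pow, ← zpow_natCast, ← zpow_natCast, ← zpow_mul, ← zpow_mul, mul_comm]
    rw [← NNReal.coe_pow]
    congr 1
    rw [normAbs_eq_inv_zpow_of_valued_eq w.1 hxn, normAbs_eq_inv_zpow_of_valued_eq v hn, residueFieldCard_adicCompletion_eq,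
      residueFieldCard_adicCompletion_eq, hq, Nat.cast_pow, hpow]

/-- **`max(‖a‖_v, ‖b‖_v)` is the norm of the coordinate with the larger valuation** (`‖·‖` is monotone in `|·|`, ★ `normAbs_le_normAbs_iff_valued`). [folklore] -/
theorem max_normAbs_eq_of_valued_le {a b : v.adicCompletion F} (hba : Valued.v b ≤ Valued.v a) :
    max ((normAbs (v.adicCompletion F) a : ℝ≥0) : ℝ) ((normAbs (v.adicCompletion F) b : ℝ≥0) : ℝ) = ((normAbs (v.adicCompletion F) a : ℝ≥0) : ℝ) := by
  refine max_eq_left ?_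
  exact_mod_cast (normAbs_le_normAbs_iff_valued v b a).2 hba

include hd in
/-- **THE INTEGRAL-BASIS NORM IN THE HEIGHT CURRENCY**: under the hypotheses of §1 and `q_w = q_v²`,
`‖ι_w a + ι_w b·δ‖_w = max(‖a‖_v, ‖b‖_v)²` (reals; `‖·‖ = normAbs`). [cite: CasselsFrohlichANT1967, Ch. I §5] [cite: Serre1979, Ch. I §6] -/
theorem normAbs_quadraticLocalEquiv_apply_eq (hw : c • w.1 = w.1) (he : v.asIdeal.ramificationIdx' w.1.asIdeal = 1)
    (h2 : Valued.v (2 : v.adicCompletion F) = 1) (hδu : Valued.v (algebraMap E (LocalRing E v) δ w) = 1) (hq : w.1.residueCard = v.residueCard ^ 2)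
    (a b : v.adicCompletion F) :
    ((normAbs (w.1.adicCompletion E) (quadraticLocalEquiv E v c hcδ hδ (a, b) w) : ℝ≥0) : ℝ) =
      (max ((normAbs (v.adicCompletion F) a : ℝ≥0) : ℝ) ((normAbs (v.adicCompletion F) b : ℝ≥0) : ℝ)) ^ 2 := by
  have hval := valued_quadraticLocalEquiv_apply_eq_max E c hcδ hδ hd v w hw he h2 hδu a b
  rcases le_total (Valued.v b) (Valued.v a) with hba | hab
  · rw [max_eq_left hba] at hval
    rw [max_normAbs_eq_of_valued_le v hba, normAbs_eq_sq_of_valued_eq E v w hq hval]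
  · rw [max_eq_right hab] at hval
    rw [max_comm, max_normAbs_eq_of_valued_le v hab, normAbs_eq_sq_of_valued_eq E v w hq hval]

include hcδ hδ hd in
/-- **The norm form in the height currency**: `‖a² − d b²‖_v = max(‖a‖_v, ‖b‖_v)²`. [cite: Serre1979, Ch. I §6] -/
theorem normAbs_sq_sub_mul_sq_eq (hw : c • w.1 = w.1) (he : v.asIdeal.ramificationIdx' w.1.asIdeal = 1)
    (h2 : Valued.v (2 : v.adicCompletion F) = 1) (hδu : Valued.v (algebraMap E (LocalRing E v) δ w) = 1) (a b : v.adicCompletion F) :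
    ((normAbs (v.adicCompletion F) (a ^ 2 - (d : v.adicCompletion F) * b ^ 2) : ℝ≥0) : ℝ) =
      (max ((normAbs (v.adicCompletion F) a : ℝ≥0) : ℝ) ((normAbs (v.adicCompletion F) b : ℝ≥0) : ℝ)) ^ 2 := by
  have hval := valued_sq_sub_mul_sq_eq E c hcδ hδ hd v w hw he h2 hδu a b
  -- compare with the square of the larger coordinate
  rcases le_total (Valued.v b) (Valued.v a) with hba | hab
  · rw [max_eq_left hba, ← Valuation.map_pow] at hval
    rw [max_normAbs_eq_of_valued_le v hba]
    have hle : normAbs (v.adicCompletion F) (a ^ 2 - (d : v.adicCompletion F) * b ^ 2) = normAbs (v.adicCompletion F) (a ^ 2) :=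
      le_antisymm ((normAbs_le_normAbs_iff_valued v _ _).2 hval.le) ((normAbs_le_normAbs_iff_valued v _ _).2 hval.ge)
    rw [hle, map_pow, NNReal.coe_pow]
  · rw [max_eq_right hab, ← Valuation.map_pow] at hval
    rw [max_comm, max_normAbs_eq_of_valued_le v hab]
    have hle : normAbs (v.adicCompletion F) (a ^ 2 - (d : v.adicCompletion F) * b ^ 2) = normAbs (v.adicCompletion F) (b ^ 2) :=
      le_antisymm ((normAbs_le_normAbs_iff_valued v _ _).2 hval.le) ((normAbs_le_normAbs_iff_valued v _ _).2 hval.ge)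
    rw [hle, map_pow, NNReal.coe_pow]

/-! ## §4 The `U(2,1)` big-cell corner `Z = ι t·δ − ½X·σX` and the height `max(1, ‖X_w‖, ‖Z_w‖)` -/

include hd in
/-- **THE CORNER ENTRY IN COORDINATES**: for `X = Ψ_v(a, b)` and `t ∈ F_v`, `ι_v t·δ − ½·X·σX = Ψ_v(−½(a² − d b²), t)` (§0 norm form). [cite: Rogawski1990, §1.10] -/
theorem corner_eq_quadraticLocalEquiv (a b t : v.adicCompletion F) :
    toLocalRing E v t * algebraMap E (LocalRing E v) δ -
        toLocalRing E v 2⁻¹ * (quadraticLocalEquiv E v c hcδ hδ (a, b) * conjLocal E c v (quadraticLocalEquiv E v c hcδ hδ (a, b))) =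
      quadraticLocalEquiv E v c hcδ hδ (-(2⁻¹ * (a ^ 2 - (d : v.adicCompletion F) * b ^ 2)), t) := by
  rw [quadraticLocalEquiv_mul_conjLocal E c hcδ hδ hd v a b, quadraticLocalEquiv_apply]
  dsimp only
  rw [map_neg, map_mul]
  ring

include hd in
/-- **`|Z_w|_w = max(max(|a|,|b|)², |t|)`** for the corner entry `Z = ι t·δ − ½X·σX`, `X = Ψ_v(a,b)`, at a non-split unramified place with `2`, `δ` units (§1 at
`(−½(a² − d b²), t)`, §2, `|½|_v = 1`). [cite: Rogawski1990, §4.5 p. 45] [cite: Serre1979, Ch. I §6] -/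
theorem valued_corner_eq_max (hw : c • w.1 = w.1) (he : v.asIdeal.ramificationIdx' w.1.asIdeal = 1)
    (h2 : Valued.v (2 : v.adicCompletion F) = 1) (hδu : Valued.v (algebraMap E (LocalRing E v) δ w) = 1) (a b t : v.adicCompletion F) :
    Valued.v ((toLocalRing E v t * algebraMap E (LocalRing E v) δ -
        toLocalRing E v 2⁻¹ * (quadraticLocalEquiv E v c hcδ hδ (a, b) * conjLocal E c v (quadraticLocalEquiv E v c hcδ hδ (a, b)))) w) =
      max (max (Valued.v a) (Valued.v b) ^ 2) (Valued.v t) := by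
  rw [corner_eq_quadraticLocalEquiv E c hcδ hδ hd v a b t, valued_quadraticLocalEquiv_apply_eq_max E c hcδ hδ hd v w hw he h2 hδu,
    Valuation.map_neg, Valuation.map_mul, Valuation.map_inv, h2, inv_one, one_mul, valued_sq_sub_mul_sq_eq E c hcδ hδ hd v w hw he h2 hδu]

/-- `max(1, M, max(M, T)²) = max(1, M, T)²` for `M ≥ 0` (`M ≤ max(1, M)²`). [folklore] -/
theorem max_one_max_sq_eq {M : ℝ} (hM : 0 ≤ M) (T : ℝ) : max 1 (max M ((max M T) ^ 2)) = (max 1 (max M T)) ^ 2 := by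
  have hMT : 0 ≤ max M T := le_max_of_le_left hM
  rcases le_total (max M T) 1 with h | h
  · have hM1 : M ≤ 1 := (le_max_left _ _).trans h
    rw [max_eq_left h, one_pow, max_eq_left]
    exact max_le hM1 (by nlinarith)
  · have hsq : max M T ≤ (max M T) ^ 2 := by nlinarith
    rw [max_eq_right h, max_eq_right ((le_max_left M T).trans hsq), max_eq_right (h.trans hsq)]

include hd in
/-- **THE `U(2,1)` BIG-CELL HEIGHT AT AN INERT PLACE, IN BASE COORDINATES.**  `v ∤ 2` non-split and unramified in `E`, `δ` a `w`-unit, `q_w = q_v²`; `X = Ψ_v(a, b) = ι a + ι b·δ`,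
`Z = ι t·δ − ½X·σX` (the last-row entries `(1, X, Z)` of `ι(w₀)·u(X, θ t)` for `U(J₃)`, ★ (a2)₃).  Then
  **`max(1, ‖X_w‖_w, ‖Z_w‖_w) = max(1, max(‖a‖_v, ‖b‖_v)², ‖t‖_v)²`**
— so the flat section `H^σ = max(1, ‖X_w‖, ‖Z_w‖)^{−σ}` along the Heisenberg chart is `max(1, max(‖a‖,‖b‖)², ‖t‖)^{−2σ}`, the integrand of ★
`K2E1IntertwiningLocalFactorU3.integral_integral_integral_inertCell_coords_eq` (whose value is FILE 1's Euler factor at `ε_v = −1`).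
[cite: Rogawski1990, §4.5 p. 45] [cite: CasselsFrohlichANT1967, Ch. I §5] [cite: Serre1979, Ch. I §6] -/
theorem max_one_norm_height_eq_sq (hw : c • w.1 = w.1) (he : v.asIdeal.ramificationIdx' w.1.asIdeal = 1)
    (h2 : Valued.v (2 : v.adicCompletion F) = 1) (hδu : Valued.v (algebraMap E (LocalRing E v) δ w) = 1) (hq : w.1.residueCard = v.residueCard ^ 2)
    (a b t : v.adicCompletion F) :
    max 1 (max ((normAbs (w.1.adicCompletion E) (quadraticLocalEquiv E v c hcδ hδ (a, b) w) : ℝ≥0) : ℝ)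
        ((normAbs (w.1.adicCompletion E) ((toLocalRing E v t * algebraMap E (LocalRing E v) δ -
          toLocalRing E v 2⁻¹ * (quadraticLocalEquiv E v c hcδ hδ (a, b) * conjLocal E c v (quadraticLocalEquiv E v c hcδ hδ (a, b)))) w) : ℝ≥0) : ℝ)) =
      (max 1 (max ((max ((normAbs (v.adicCompletion F) a : ℝ≥0) : ℝ) ((normAbs (v.adicCompletion F) b : ℝ≥0) : ℝ)) ^ 2)
        ((normAbs (v.adicCompletion F) t : ℝ≥0) : ℝ))) ^ 2 := by
  set M : ℝ := (max ((normAbs (v.adicCompletion F) a : ℝ≥0) : ℝ) ((normAbs (v.adicCompletion F) b : ℝ≥0) : ℝ)) ^ 2 with hM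
  set T : ℝ := ((normAbs (v.adicCompletion F) t : ℝ≥0) : ℝ)
  have hM0 : 0 ≤ M := by positivity
  -- `‖X_w‖ = M`
  have hX := normAbs_quadraticLocalEquiv_apply_eq E c hcδ hδ hd v w hw he h2 hδu hq a b
  -- `‖Z_w‖ = max(M, T)²`: `Z = Ψ(−½(a² − d b²), t)` and §3 at those coordinates
  have hZ : ((normAbs (w.1.adicCompletion E) ((toLocalRing E v t * algebraMap E (LocalRing E v) δ -
      toLocalRing E v 2⁻¹ * (quadraticLocalEquiv E v c hcδ hδ (a, b) * conjLocal E c v (quadraticLocalEquiv E v c hcδ hδ (a, b)))) w) : ℝ≥0) : ℝ) = (max M T) ^ 2 := by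
    rw [corner_eq_quadraticLocalEquiv E c hcδ hδ hd v a b t, normAbs_quadraticLocalEquiv_apply_eq E c hcδ hδ hd v w hw he h2 hδu hq]
    congr 1
    rw [hM, normAbs_neg, map_mul, map_inv₀, ← normAbs_sq_sub_mul_sq_eq E c hcδ hδ hd v w hw he h2 hδu a b]
    -- `‖2⁻¹‖ = 1`
    have h2n : normAbs (v.adicCompletion F) 2 = 1 :=
      le_antisymm (by rw [← map_one (normAbs (v.adicCompletion F)), normAbs_le_normAbs_iff_valued, h2, Valuation.map_one])
        (by rw [← map_one (normAbs (v.adicCompletion F)), normAbs_le_normAbs_iff_valued, h2, Valuation.map_one])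
    rw [h2n, inv_one, one_mul]
  rw [hX, hZ]
  exact max_one_max_sq_eq hM0 T

end Summit.HodgeConjecture.HodgeConjecture.Cruxes.H413.K2E1IntertwiningLocalFactorU3Height

end
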